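import Mathlib
import HarnessLib

/-!
# Sparse-support ceiling for exact-coefficient Fourier-restricted Navier–Stokes systems —
# the finite-dimensional core ("one dyadic step") of the regularity theorem

HONEST FRAMING (cell `ns-blowup`, seat `ns-blowup-circuit`, human ruling D-0035): this cell
ATTEMPTS the negative direction of the Clay problem; nothing in this file is a claim about
Navier–Stokes blow-up. WHAT THIS IS NOT: not a statement about the Navier–Stokes equations on
`ℝ³`/`𝕋³` with their full Fourier support; it is an a-priori estimate for FINITE systems of damped,
quadratically forced ODEs whose forcing obeys the structural bound satisfied by every
Galerkin / Fourier-RESTRICTED Navier–Stokes system with the TRUE `(u·∇)u` coefficients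
(memo `run/shared/lean/pub/ns-blowup/CIRCUIT-OBSTRUCTIONS.md`, Theorem A, §A.3 steps (3)–(4)).

## Setting (abstract, so that the kernel checks exactly what the memo uses)

A finite index type `ι` of "modes" `i` with amplitudes `u t i` in a real inner-product space `E`
(for NS: `E = ℂ³` as a real space, or one real polarisation as in Miller arXiv:2307.03434), a
"wavenumber" `κ i`, a damping rate `d i > 0` (for NS: `ν κ i ^ (2α)`), a coefficient weight
`c i ≥ 0` (for NS: `κ i`, the bound `|coefficient| ≤ |k|` of the ordered pair `(p, k - p)`), a finite
partner list `N i` with an injective "third leg" map `σ i` on it (for NS: `p ↦ k - p`), the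
triangle-inequality consequence `κ i ≤ 2 κ j ∨ κ i ≤ 2 κ (σ i j)` for partners, the mode equation
`(u · i)' = -(d i) • u t i + f t i` on `[0,T)` with
`‖f t i‖ ≤ c i * ∑ j ∈ N i, ‖u t j‖ * ‖u t (σ i j)‖ + φ i` (`φ i` = an external force bound), and the
energy bound `∑ i, ‖u t i‖² ≤ E₀`.

## What is typed

* `norm_le_max_of_damped` — a damped linear ODE `x' = -d•x + f`, `‖f‖ ≤ F` on `[0,T)`, obeys
  `‖x t‖ ≤ max ‖x 0‖ (F/d)` on `[0,T]` (barrier argument on `‖x‖²`,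
  `image_le_of_deriv_right_lt_deriv_boundary'`).
* `pair_sum_le` — the Cauchy–Schwarz step: if every partner pair has a HIGH member (predicate `P`)
  and high amplitudes are `≤ a`, then `∑ j ∈ N, v j * v (σ j) ≤ 2 √E₀ √#N a`.
* `sparse_step` — ONE DYADIC STEP of the ceiling: if all modes with `R ≤ 2 κ j` are bounded by `A`
  on `[0,T)`, then every mode with `R ≤ κ i` obeys
  `‖u t i‖ ≤ max ‖u 0 i‖ ((c i * (2 √E₀ √#(N i) A) + φ i) / d i)` on `[0,T]`.
  With `c i = κ i`, `d i = ν κ i²`, `#(N i) = D_i` this is `a(R) ≤ b(R) + θ(R)·a(R/2) + (force tail)`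
  with `θ(R) = (2√E₀/ν) sup_{κ i ≥ R} √D_i / κ i` — the recursion of memo §A.3 (4); `θ → 0`
  ("sparse": `D_i = o(κ i²)`) iterated over dyadic `R` gives superpolynomial decay of
  `sup_t ‖u t i‖` in `κ i`, uniformly in `T` and in the truncation (memo §A.3 (5), §G.2 with force).
* `geometric_ceiling` — the elementary iteration `a (j+1) ≤ B + q a j ⇒ a j ≤ q^j a 0 + B/(1-q)`.

## Honest limits
(i) The PDE statements (local well-posedness of the restricted system, continuation criterion,
passage to infinite `S`) are NOT here; they are verbatim those of Galerkin NS and are cited in the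
memo (Miller Thm 1.7/1.8). (ii) Nothing here applies to THICK supports (`D_i ≳ κ i²`: Tao balls,
full shells) — there `θ ↛ 0`. (iii) MODEL-side real analysis; not a statement about Navier–Stokes.
-/

namespace Summit.NavierStokesRegularity.FluidComputer.SparseSupportCeiling

open Set Finset

section Damped

variable {E : Type*} [NormedAddCommGroup E] [InnerProductSpace ℝ E]

/-- Barrier estimate for a damped, forced linear ODE in a real inner-product space: if
`x' = -(d • x) + f` on `[0,T)` (right derivatives), `x` is continuous on `[0,T]`, `d > 0` and
`‖f t‖ ≤ F` on `[0,T)`, then `‖x t‖ ≤ max ‖x 0‖ (F / d)` on `[0,T]`. (Memo Theorem A, step (4).) -/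
theorem norm_le_max_of_damped {x f : ℝ → E} {d F T : ℝ} (hd : 0 < d)
    (hcont : ContinuousOn x (Icc 0 T))
    (hderiv : ∀ t ∈ Ico 0 T, HasDerivWithinAt x (-(d • x t) + f t) (Ici t) t)
    (hf : ∀ t ∈ Ico 0 T, ‖f t‖ ≤ F) :
    ∀ t ∈ Icc 0 T, ‖x t‖ ≤ max ‖x 0‖ (F / d) := by
  intro t ht
  apply le_of_forall_gt_imp_ge_of_dense
  intro M hM
  have hM0 : ‖x 0‖ < M := lt_of_le_of_lt (le_max_left _ _) hM
  have hMF : F / d < M := lt_of_le_of_lt (le_max_right _ _) hM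
  have hMpos : 0 < M := lt_of_le_of_lt (norm_nonneg _) hM0
  have hFdM : F < d * M := by rwa [div_lt_iff₀ hd, mul_comm] at hMF
  -- barrier argument on φ = ‖x‖²
  set φ : ℝ → ℝ := fun s => ‖x s‖ ^ 2 with hφ
  set φ' : ℝ → ℝ := fun s => 2 * inner ℝ (x s) (-(d • x s) + f s) with hφ'
  have hφcont : ContinuousOn φ (Icc 0 T) := (hcont.norm).pow 2
  have hφderiv : ∀ s ∈ Ico 0 T, HasDerivWithinAt φ (φ' s) (Ici s) s :=
    fun s hs => (hderiv s hs).norm_sq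
  have hB : ContinuousOn (fun _ : ℝ => M ^ 2) (Icc 0 T) := continuousOn_const
  have hB' : ∀ s ∈ Ico 0 T,
      HasDerivWithinAt (fun _ : ℝ => M ^ 2) ((fun _ : ℝ => (0 : ℝ)) s) (Ici s) s :=
    fun s _ => hasDerivWithinAt_const _ _ _
  have h0 : φ 0 ≤ (fun _ : ℝ => M ^ 2) 0 := by
    simp only [hφ]
    exact pow_le_pow_left₀ (norm_nonneg _) hM0.le 2
  have hbound : ∀ s ∈ Ico 0 T, φ s = (fun _ : ℝ => M ^ 2) s → φ' s < (fun _ : ℝ => (0 : ℝ)) s := by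
    intro s hs hEq
    simp only [hφ] at hEq
    simp only [hφ']
    have hxs : ‖x s‖ = M := by
      have h := congrArg Real.sqrt hEq
      rwa [Real.sqrt_sq (norm_nonneg _), Real.sqrt_sq hMpos.le] at h
    have h1 : inner ℝ (x s) (-(d • x s) + f s) = -d * ‖x s‖ ^ 2 + inner ℝ (x s) (f s) := by
      rw [inner_add_right, inner_neg_right, inner_smul_right, real_inner_self_eq_norm_sq]
      ring
    have h2 : inner ℝ (x s) (f s) ≤ ‖x s‖ * ‖f s‖ := real_inner_le_norm _ _
    have h3 : ‖x s‖ * ‖f s‖ ≤ M * F := by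
      rw [hxs]; exact mul_le_mul_of_nonneg_left (hf s hs) hMpos.le
    rw [h1, hxs]
    nlinarith
  have key := image_le_of_deriv_right_lt_deriv_boundary' hφcont hφderiv h0 hB hB' hbound ht
  simp only [hφ] at key
  nlinarith [norm_nonneg (x t)]

end Damped

section Pairs

variable {ι : Type*} [Fintype ι] [DecidableEq ι]

omit [Fintype ι] [DecidableEq ι] in
/-- Cauchy–Schwarz on a finset, in square-root form. -/
theorem sum_mul_le_sqrt_mul_sqrt (s : Finset ι) (f g : ι → ℝ) :
    ∑ i ∈ s, f i * g i ≤ Real.sqrt (∑ i ∈ s, f i ^ 2) * Real.sqrt (∑ i ∈ s, g i ^ 2) := by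
  have h := Finset.sum_mul_sq_le_sq_mul_sq s f g
  have h1 : ∑ i ∈ s, f i * g i ≤ |∑ i ∈ s, f i * g i| := le_abs_self _
  rw [← Real.sqrt_sq_eq_abs] at h1
  refine h1.trans ?_
  rw [← Real.sqrt_mul (Finset.sum_nonneg fun i _ => sq_nonneg (f i))]
  exact Real.sqrt_le_sqrt h

/-- THE CAUCHY–SCHWARZ STEP (memo Theorem A, step (3)). `N` = partner list of one mode, `σ` = the
injective "third leg" map (`p ↦ k - p`), `v` = the non-negative amplitudes with energy `∑ v² ≤ E₀`,
`P` = "high" (modulus at least half that of the forced mode); every partner pair has a high member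
(`hP`, the triangle inequality) and high amplitudes are `≤ a`. Then the pair sum is
`≤ 2 √E₀ √#N a`. -/
theorem pair_sum_le (N : Finset ι) (σ : ι → ι) (hσ : Set.InjOn σ ↑N) (v : ι → ℝ)
    (hv : ∀ i, 0 ≤ v i) {E₀ : ℝ} (hE : ∑ i, v i ^ 2 ≤ E₀) (P : ι → Prop) [DecidablePred P]
    (hP : ∀ j ∈ N, P j ∨ P (σ j)) {a : ℝ} (ha0 : 0 ≤ a) (ha : ∀ i, P i → v i ≤ a) :
    ∑ j ∈ N, v j * v (σ j) ≤ 2 * Real.sqrt E₀ * Real.sqrt N.card * a := by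
  have hsplit : ∑ j ∈ N, v j * v (σ j) =
      ∑ j ∈ N.filter (fun j => P (σ j)), v j * v (σ j) +
        ∑ j ∈ N.filter (fun j => ¬ P (σ j)), v j * v (σ j) :=
    (Finset.sum_filter_add_sum_filter_not N (fun j => P (σ j)) _).symm
  set N₁ := N.filter (fun j => P (σ j)) with hN₁
  set N₂ := N.filter (fun j => ¬ P (σ j)) with hN₂
  have hsq_a : ∀ i, P i → v i ^ 2 ≤ a ^ 2 := fun i hi => pow_le_pow_left₀ (hv i) (ha i hi) 2
  have hsqrt_card : Real.sqrt (N.card * a ^ 2) = Real.sqrt N.card * a := by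
    rw [Real.sqrt_mul (Nat.cast_nonneg _), Real.sqrt_sq ha0]
  -- part 1 : partners whose third leg is high
  have h1a : ∑ j ∈ N₁, v j ^ 2 ≤ E₀ :=
    le_trans (Finset.sum_le_univ_sum_of_nonneg fun i => sq_nonneg (v i)) hE
  have h1b : ∑ j ∈ N₁, v (σ j) ^ 2 ≤ N.card * a ^ 2 := by
    calc ∑ j ∈ N₁, v (σ j) ^ 2 ≤ ∑ j ∈ N₁, a ^ 2 :=
          Finset.sum_le_sum fun j hj => hsq_a _ (Finset.mem_filter.mp hj).2
      _ = N₁.card * a ^ 2 := by rw [Finset.sum_const, nsmul_eq_mul]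
      _ ≤ N.card * a ^ 2 := by
          gcongr
          exact Finset.filter_subset _ _
  have hpart1 : ∑ j ∈ N₁, v j * v (σ j) ≤ Real.sqrt E₀ * (Real.sqrt N.card * a) := by
    refine (sum_mul_le_sqrt_mul_sqrt N₁ (fun j => v j) (fun j => v (σ j))).trans ?_
    rw [← hsqrt_card]
    exact mul_le_mul (Real.sqrt_le_sqrt h1a) (Real.sqrt_le_sqrt h1b) (Real.sqrt_nonneg _)
      (Real.sqrt_nonneg _)
  -- part 2 : partners that are themselves high
  have h2a : ∑ j ∈ N₂, v j ^ 2 ≤ N.card * a ^ 2 := by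
    calc ∑ j ∈ N₂, v j ^ 2 ≤ ∑ j ∈ N₂, a ^ 2 := Finset.sum_le_sum fun j hj => by
            have hj' := Finset.mem_filter.mp hj
            rcases hP j hj'.1 with h | h
            · exact hsq_a j h
            · exact absurd h hj'.2
      _ = N₂.card * a ^ 2 := by rw [Finset.sum_const, nsmul_eq_mul]
      _ ≤ N.card * a ^ 2 := by
          gcongr
          exact Finset.filter_subset _ _
  have hσ₂ : Set.InjOn σ ↑N₂ := hσ.mono (fun j hj => (Finset.mem_filter.mp hj).1)
  have h2b : ∑ j ∈ N₂, v (σ j) ^ 2 ≤ E₀ := by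
    rw [show ∑ j ∈ N₂, v (σ j) ^ 2 = ∑ i ∈ N₂.image σ, v i ^ 2 from
      (Finset.sum_image (f := fun i => v i ^ 2) hσ₂).symm]
    exact le_trans (Finset.sum_le_univ_sum_of_nonneg fun i => sq_nonneg (v i)) hE
  have hpart2 : ∑ j ∈ N₂, v j * v (σ j) ≤ (Real.sqrt N.card * a) * Real.sqrt E₀ := by
    refine (sum_mul_le_sqrt_mul_sqrt N₂ (fun j => v j) (fun j => v (σ j))).trans ?_
    rw [← hsqrt_card]
    exact mul_le_mul (Real.sqrt_le_sqrt h2a) (Real.sqrt_le_sqrt h2b) (Real.sqrt_nonneg _)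
      (Real.sqrt_nonneg _)
  rw [hsplit]
  nlinarith [hpart1, hpart2, Real.sqrt_nonneg E₀, Real.sqrt_nonneg (N.card : ℝ), ha0]

end Pairs

section Step

variable {ι : Type*} [Fintype ι] [DecidableEq ι]
variable {E : Type*} [NormedAddCommGroup E] [InnerProductSpace ℝ E]

/-- ONE DYADIC STEP OF THE SPARSE-SUPPORT CEILING (memo Theorem A, steps (3)–(4) combined). A finite
family of damped, quadratically forced amplitudes `u t i ∈ E` on `[0,T]`: damping `d i > 0`,
forcing bounded by `c i * ∑ j ∈ N i, ‖u t j‖ * ‖u t (σ i j)‖ + φ i` with an injective third-leg map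
`σ i` on the partner list `N i` and every partner pair containing a mode of modulus `≥ κ i / 2`
(`hhigh`), energy `∑ i, ‖u t i‖² ≤ E₀`. If all modes with `R ≤ 2 κ j` are bounded by `A` on `[0,T)`,
then every mode with `R ≤ κ i` obeys
`‖u t i‖ ≤ max ‖u 0 i‖ ((c i * (2 √E₀ √#(N i) A) + φ i) / d i)` on `[0,T]`.
For a Fourier-restricted Navier–Stokes system (`c i = κ i`, `d i = ν κ i ^ 2`, `#(N i) = D_i` the
triad degree) the second entry is `(2√E₀/ν)(√D_i/κ i)·A + φ i/(ν κ i²)`: the factor in front of `A`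
tends to `0` exactly when the support is SPARSE (`D_i = o(κ i²)`), and iterating the step over
dyadic `R` yields superpolynomial decay of `sup_t ‖u t i‖` (memo §A.3 (5), §G.2). -/
theorem sparse_step {u f : ℝ → ι → E} {κ c d φ : ι → ℝ} {N : ι → Finset ι} {σ : ι → ι → ι}
    {E₀ T R A : ℝ}
    (hd : ∀ i, 0 < d i) (hc : ∀ i, 0 ≤ c i)
    (hcont : ∀ i, ContinuousOn (fun t => u t i) (Icc 0 T))
    (hderiv : ∀ i, ∀ t ∈ Ico 0 T,
      HasDerivWithinAt (fun s => u s i) (-(d i • u t i) + f t i) (Ici t) t)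
    (henergy : ∀ t ∈ Ico 0 T, ∑ i, ‖u t i‖ ^ 2 ≤ E₀)
    (hforce : ∀ i, ∀ t ∈ Ico 0 T,
      ‖f t i‖ ≤ c i * ∑ j ∈ N i, ‖u t j‖ * ‖u t (σ i j)‖ + φ i)
    (hσ : ∀ i, Set.InjOn (σ i) ↑(N i))
    (hhigh : ∀ i, ∀ j ∈ N i, κ i ≤ 2 * κ j ∨ κ i ≤ 2 * κ (σ i j))
    (hA0 : 0 ≤ A) (hA : ∀ t ∈ Ico 0 T, ∀ j, R ≤ 2 * κ j → ‖u t j‖ ≤ A) :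
    ∀ i, R ≤ κ i → ∀ t ∈ Icc 0 T,
      ‖u t i‖ ≤ max ‖u 0 i‖ ((c i * (2 * Real.sqrt E₀ * Real.sqrt (N i).card * A) + φ i) / d i) := by
  classical
  intro i hi t ht
  refine norm_le_max_of_damped (x := fun s => u s i) (f := fun s => f s i) (hd i) (hcont i)
    (hderiv i) ?_ t ht
  intro s hs
  refine (hforce i s hs).trans ?_
  have hP : ∀ j ∈ N i, R ≤ 2 * κ j ∨ R ≤ 2 * κ (σ i j) := by
    intro j hj
    rcases hhigh i j hj with h | h
    · left; linarith
    · right; linarith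
  have hpair := pair_sum_le (N i) (σ i) (hσ i) (fun j => ‖u s j‖) (fun j => norm_nonneg _)
    (henergy s hs) (fun j => R ≤ 2 * κ j) hP hA0 (fun j hj => hA s hs j hj)
  have := mul_le_mul_of_nonneg_left hpair (hc i)
  linarith

end Step

section Iterate

/-- The elementary iteration behind "sparse ⇒ superpolynomial decay": if `a (j+1) ≤ B + q * a j`
with `0 ≤ q < 1` and `0 ≤ B`, then `a j ≤ q ^ j * a 0 + B / (1 - q)`. (Applied on each dyadic
block with `q = θ(R)` from `sparse_step` and `B` = the data/force tail.) -/
theorem geometric_ceiling {a : ℕ → ℝ} {q B : ℝ} (hq0 : 0 ≤ q) (hq1 : q < 1) (hB : 0 ≤ B)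
    (h : ∀ j, a (j + 1) ≤ B + q * a j) : ∀ j, a j ≤ q ^ j * a 0 + B / (1 - q) := by
  have h1q : 0 < 1 - q := sub_pos.mpr hq1
  intro j
  induction j with
  | zero =>
    have h0 : 0 ≤ B / (1 - q) := div_nonneg hB h1q.le
    simp only [pow_zero, one_mul]
    linarith
  | succ j ih =>
    calc a (j + 1) ≤ B + q * a j := h j
      _ ≤ B + q * (q ^ j * a 0 + B / (1 - q)) := by gcongr
      _ = q ^ (j + 1) * a 0 + (B + q * (B / (1 - q))) := by ring
      _ = q ^ (j + 1) * a 0 + B / (1 - q) := by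
          congr 1
          field_simp
          ring

end Iterate

section Ceiling

variable {ι : Type*} [Fintype ι] [DecidableEq ι]
variable {E : Type*} [NormedAddCommGroup E] [InnerProductSpace ℝ E]

omit [DecidableEq ι] [InnerProductSpace ℝ E] in
/-- A single amplitude is bounded by the square root of the energy. -/
theorem norm_le_sqrt_energy {v : ι → E} {E₀ : ℝ} (hE : ∑ i, ‖v i‖ ^ 2 ≤ E₀) (i : ι) :
    ‖v i‖ ≤ Real.sqrt E₀ := by
  have h1 : ‖v i‖ ^ 2 ≤ ∑ j, ‖v j‖ ^ 2 :=
    Finset.single_le_sum (fun j _ => sq_nonneg ‖v j‖) (Finset.mem_univ i)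
  calc ‖v i‖ = Real.sqrt (‖v i‖ ^ 2) := (Real.sqrt_sq (norm_nonneg _)).symm
    _ ≤ Real.sqrt E₀ := Real.sqrt_le_sqrt (h1.trans hE)

/-- ALL DYADIC STEPS, uniform-floor version (memo Theorem A, step (5), appended 2026-08-25 by the same
seat). In the setting of `sparse_step`, suppose that above a threshold wavenumber `R₀ ≥ 0` the data
are bounded by `β` (`‖u 0 i‖ ≤ β`), the force by `β' · d i` (`φ i ≤ β' * d i`), and the support is
SPARSE in the quantitative form `c i * (2 √E₀ √#(N i)) ≤ q * d i` with a fixed ratio `q < 1`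
(for Fourier-restricted NS: `(2√E₀/ν) √D_i / κ i ≤ q`). Then at dyadic level `j` — i.e. for every
mode with `2^j R₀ ≤ κ i` — and every `t ∈ [0,T)`,
`‖u t i‖ ≤ q ^ j * √E₀ + (β + β') / (1 - q)`:
the amplitudes decay like the power `κ^{-log₂(1/q)}` down to the data/force floor, with constants
independent of `T` and of the size of the (finite) system. Letting the floor itself decay in the
level (apply the theorem with `R₀ ↦ 2^m R₀`) gives the superpolynomial decay of the memo. -/
theorem sparse_ceiling {u f : ℝ → ι → E} {κ c d φ : ι → ℝ} {N : ι → Finset ι} {σ : ι → ι → ι}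
    {E₀ T R₀ q β β' : ℝ}
    (hd : ∀ i, 0 < d i) (hc : ∀ i, 0 ≤ c i)
    (hcont : ∀ i, ContinuousOn (fun t => u t i) (Icc 0 T))
    (hderiv : ∀ i, ∀ t ∈ Ico 0 T,
      HasDerivWithinAt (fun s => u s i) (-(d i • u t i) + f t i) (Ici t) t)
    (henergy : ∀ t ∈ Ico 0 T, ∑ i, ‖u t i‖ ^ 2 ≤ E₀)
    (hforce : ∀ i, ∀ t ∈ Ico 0 T,
      ‖f t i‖ ≤ c i * ∑ j ∈ N i, ‖u t j‖ * ‖u t (σ i j)‖ + φ i)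
    (hσ : ∀ i, Set.InjOn (σ i) ↑(N i))
    (hhigh : ∀ i, ∀ j ∈ N i, κ i ≤ 2 * κ j ∨ κ i ≤ 2 * κ (σ i j))
    (hR₀ : 0 ≤ R₀) (hq0 : 0 ≤ q) (hq1 : q < 1) (hβ : 0 ≤ β) (hβ' : 0 ≤ β')
    (hdata : ∀ i, R₀ ≤ κ i → ‖u 0 i‖ ≤ β)
    (hφ : ∀ i, R₀ ≤ κ i → φ i ≤ β' * d i)
    (hsparse : ∀ i, R₀ ≤ κ i → c i * (2 * Real.sqrt E₀ * Real.sqrt (N i).card) ≤ q * d i) :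
    ∀ j : ℕ, ∀ i, 2 ^ j * R₀ ≤ κ i → ∀ t ∈ Ico 0 T,
      ‖u t i‖ ≤ q ^ j * Real.sqrt E₀ + (β + β') / (1 - q) := by
  classical
  -- the recursively defined level bounds
  let A : ℕ → ℝ := fun j => Nat.rec (Real.sqrt E₀) (fun _ a => (β + β') + q * a) j
  have hA0 : A 0 = Real.sqrt E₀ := rfl
  have hAsucc : ∀ j, A (j + 1) = (β + β') + q * A j := fun j => rfl
  have hApos : ∀ j, 0 ≤ A j := by
    intro j
    induction j with
    | zero => rw [hA0]; exact Real.sqrt_nonneg _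
    | succ j ih => rw [hAsucc]; positivity
  -- the induction: level j modes are bounded by A j on [0,T)
  have key : ∀ j : ℕ, ∀ i, 2 ^ j * R₀ ≤ κ i → ∀ t ∈ Ico 0 T, ‖u t i‖ ≤ A j := by
    intro j
    induction j with
    | zero =>
      intro i _ t ht
      rw [hA0]
      exact norm_le_sqrt_energy (henergy t ht) i
    | succ j ih =>
      intro i hi t ht
      have hR : (2 : ℝ) ^ (j + 1) * R₀ ≤ κ i := hi
      have hstep := sparse_step (R := 2 ^ (j + 1) * R₀) (A := A j) hd hc hcont hderiv henergy
        hforce hσ hhigh (hApos j) (by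
          intro s hs i' hi'
          refine ih i' ?_ s hs
          have : (2 : ℝ) ^ (j + 1) * R₀ = 2 * (2 ^ j * R₀) := by ring
          linarith) i hR t (Ico_subset_Icc_self ht)
      have hκ : R₀ ≤ κ i := by
        have h2 : (1 : ℝ) ≤ 2 ^ (j + 1) := one_le_pow₀ (by norm_num)
        nlinarith
      rw [hAsucc]
      refine hstep.trans (max_le ?_ ?_)
      · have := hdata i hκ
        have := hApos j
        nlinarith
      · rw [div_le_iff₀ (hd i)]
        have h1 := mul_le_mul_of_nonneg_right (hsparse i hκ) (hApos j)
        have h2 := hφ i hκ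
        have h3 := hd i
        nlinarith
  -- solve the recursion
  have hgeo := geometric_ceiling (a := A) hq0 hq1 (by positivity : 0 ≤ β + β')
    (fun j => (hAsucc j).le)
  intro j i hi t ht
  exact (key j i hi t ht).trans (by simpa [hA0] using hgeo j)

end Ceiling

end Summit.NavierStokesRegularity.FluidComputer.SparseSupportCeiling
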